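import Summits.QuantumFields.YangMills.Theorems.UnitScaleTiltProp7MassiveSolutionGradientSup
import HarnessLib

/-!
# Route `UnitScaleTilt`, crux K1 «MinimiserStabilityRegPr» (stmt-QuantumFields-19200), EX face, norm_G ∕ h133 road — N6 FILE D letter (dκ), part 1 of 2:
# **THE DECAYED GRADIENT ROW OF A COVARIANT POISSON-TYPE EQUATION** — for ANY site fields `u, q` with `Δ^η_{U₀}u + q = D*_{U₀}0` at a printed-regular background, if `u` and `q`
# DECAY off a block `y` (`‖u(x)‖ ≤ A_u·e^{−κ·d(B x, y)}`, `‖q(x)‖ ≤ A_q·e^{−κ·d(B x, y)}`, coarse `ℓ¹` block distance), then SO DOES THE COVARIANT GRADIENT: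
# `‖(D_{U₀}u)(b)‖ ≤ 2·M(A_u e^{51κ}, A_q e^{51κ})·e^{−κ·d(B b₋, y)}` — px19 g13's T1-core ✓`Prop7MassiveSolutionGradientSup.perBond_gradient_le_of_sup` with its three sup letters
# LOCALISED to the `12ℓ+4` ball (§1), then px12 g15's ✓`Prop7WeightedGradientAbsorption.weighted_sup_absorption` at `κ ≥ 0` with input radius `51` (§2).
# (★p1 g27 CHAIR WORD №30 (2) «(dκ) N5-blk … T1 is local»; px5 g13 10:35:44Z «the OF-GRAD assembly re-run with LOCAL sups»; width seat `ym3-torus-px21` g15.)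

Cell `ym3-torus` (HUMAN RULING D-0037; rung R3 = SU(2) YM₃ on T³ — NOT d = 4, NOT infinite volume, NOT a mass gap, NOT Clay).  THEOREMS ONLY (0 `def`, 0 `sorry`, default heartbeats);
`--supports stmt-QuantumFields-19200 --as helper`; count-neutral.

THE MATHEMATICS ([Balaban1985BackgroundPropagators] Thm 3.1 (3.42)–(3.44): local estimates on cubes (3.45)–(3.47), then the exponentially weighted sup, pp.397–399; [Balaban1984PropagatorsII]
Lemma 2.1).  §1 is T1-core §1 VERBATIM in proof (torus axial gauge `V := U₀^{axialT U₀ b₋}`, the conjugation isometries `Φ∕Ψ` ✓`exists_adIsometries_pointwise`, the transported equation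
✓`memberEquation_gaugeAct`, (G1-3a) ✓`exists_curved_localGradient` at `(V, Φu, Φq, 0, x)` fed with the chart-glue rows ✓`norm_bgOfCfg_axialT_sub_one_le_of_ball`∕(★) and the read-back
✓`norm_DL2_le`, ✓`regroup_bracket`) — the ONLY change is that the three letters `M_u`, `M_q`, `G_b` are asked on the `12ℓ+4` sup-ball of `b₋` (fine torus distance) resp. on the bonds
within coarse distance `51` of `B b₋` (✓`tdist_iterBlockOf_le_of_ball`), which is all the proof ever reads.  §2: a decayed field is bounded on that ball by `A·e^{51κ}·e^{−κ d(B b₋, y)}`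
(✓`decay_on_ball`), so §1 is the `hloc` of the weighted absorption with `m(b) = M·e^{−κ d(B b₋, y)}`, `a = C_g·48ε₀(6√2√10 + 6√2)`, margin `a·e^{51κ} ≤ ½`.
WHAT IS PROVED (ns `Summit.QuantumFields.YangMills.Theorems.Prop7PoissonGradientDecay`; member `F`, `n ≤ K` implicit in the carriers, `ℓ = L^{K−n}`).
* §1 ★★ `perBond_gradient_le_of_ball` — the per-bond letter with BALL-LOCAL sups: `‖(D_{U₀}u)(b)‖ ≤ M₀(M_u, M_q) + C_g·(48ε₀(6√2√10 + 6√2))·G_b`, `M₀` = T1-core's bracket.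
* §2 ★★★ `gradient_decay_of_decay` — the DECAYED GRADIENT ROW: `‖(D_{U₀}u)(bondEquiv b)‖ ≤ 2·M₀(A_u e^{51κ}, A_q e^{51κ})·e^{−κ·d(B b₋, y)}` for all route bonds `b`, under `RegPr`, `0 < ε₀ ≤ 1`,
  the no-wrap room `2(12ℓ + 5) ≤ sitesPerDir` and the margin `C_g·(48ε₀(6√2√10 + 6√2))·e^{51κ} ≤ ½`; ★★ `gradient_decay_of_decay'` — the same read on route bonds through ✓`toL2`
  (`‖toL2⁻¹(D_{U₀}u) b‖`, operator norm ≤ Frobenius norm).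
HYP-SAT (★★OWNER RULING №42).  `RegPr` (both clauses; the EX face's standing hypothesis), `0 < ε₀ ≤ 1`, the equation (an equality), two decayed sup letters (real-inequality schemas, inhabited
e.g. by px16 ✓`Prop7OneFormGreenSupBound.norm_symm_GT_apply_le_of_blockSupport` for the components of `G₀X` — part 2), `hroom` (CHAIR WORD №1 class), `hsmall` (smallness of `ε₀` vs the
universal `C_g`, K-FREE).  Conclusions non-vacuous; no `Prop` placeholder; nothing conclusion-shaped is assumed.
HONEST SCOPE.  Composition of landed rows; nothing of (dκ) proper (part 2), FILE D, `norm_G`, `h133`, the EX rows, EX, 19200 or the rung is proved here; the Yang–Mills mass gap is NOT proved.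

References: T. Bałaban, CMP **99** (1985) 389–434 [Balaban1985BackgroundPropagators] ((3.3) p.391, (3.23) p.394, Thm 3.1 (3.42)–(3.47) pp.397–399); CMP **96** (1984) 223–250
[Balaban1984PropagatorsII] (Lemma 2.1 (2.8)–(2.10) pp.227–228, (2.61)–(2.63) p.234); CMP **98** (1985) 17–51 [Balaban1985Averaging] ((19) p.21, pp.24–25).
-/

set_option autoImplicit false

noncomputable section

open scoped BigOperators Matrix.Norms.L2Operator InnerProductSpace ComplexConjugate

namespace Summit.QuantumFields.YangMills.Theorems.Prop7PoissonGradientDecay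

open Literature.MathematicalPhysics.QuantumFieldTheory.Balaban1983to89
open Literature.MathematicalPhysics.QuantumFieldTheory.Balaban1983to89.T3ContinuumYM3Torus
open B10Eq27TorusAxialLog (axialT)
open B4Sect5Torus (TSite tdist tdist_triangle tdist_self tdist_nonneg)
open B9SectCLatticeCarrier (Bond shift tdist_shift_le)
open B9Eq311L2Pairing (WL2)
open B11Eq103H1Complex (SiteL2K BondL2K)
open B5Eq118OneStroke (iterBlockOf)
open T3RegularMinimiser (regThreshold)
open T3PrintedRegularMinimiser (RegPr)
open Summit.QuantumFields.YangMills.Theorems.Prop7SectET3Transport (periodsT3 siteEquiv bondEquiv bondEquiv_apply bgOfCfg)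
open Summit.QuantumFields.YangMills.Theorems.Prop7SectET3HilbertLetters (W₂ frobEquiv toL2 DL2 DstarL2 covLapSite toL2_symm_apply)
open Summit.QuantumFields.YangMills.Theorems.Prop7RieszTauFrobNorm (norm_frobEquiv_le)
open Summit.QuantumFields.YangMills.Theorems.Prop7TwoBackgroundGradientComparison (one_le_periodsT3 norm_DL2_le)
open Summit.QuantumFields.YangMills.Theorems.Prop7CurvedMemberLocalGradient (exists_curved_localGradient)
open Summit.QuantumFields.YangMills.Theorems.Prop7WeightedGradientAbsorption (weighted_sup_absorption)
open Summit.QuantumFields.YangMills.Theorems.Prop7GaugeCovariancePointwise (exists_adIsometries_pointwise ell_mul_norm_sub_le_of_rows memberEquation_gaugeAct)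
open Summit.QuantumFields.YangMills.Theorems.AxialGaugeChartGlue (norm_bgOfCfg_axialT_sub_le)
open Summit.QuantumFields.YangMills.Theorems.Prop7CurvedMemberBallLetters (natCast_radius tdist_iterBlockOf_le_of_ball decay_on_ball norm_bgOfCfg_axialT_sub_one_le_of_ball
  ell_mul_delta_ball_le ell_mul_theta_ball_le)
open Summit.QuantumFields.YangMills.Theorems.Prop7CurvedMemberGradientRow (regroup_bracket)

variable (F : T3Family) (n K : ℕ) {ε₀ : ℝ} (hε₀ : 0 < ε₀) (hε1 : ε₀ ≤ 1)
  (U₀ : GaugeField (F.P K) 0 (Matrix.specialUnitaryGroup (Fin 2) ℂ)) (hreg : RegPr F n K ε₀ U₀)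
  (c₀ : ℝ) [Fact (0 < c₀)]

/-! ## §1 The per-bond letter with ball-local sups -/

include hε₀ hε1 hreg in
/-- ★★ **THE PER-BOND GRADIENT LETTER OF A COVARIANT POISSON-TYPE EQUATION WITH BALL-LOCAL SUP LETTERS.**  For `u q` with `Δ^η_{U₀}u + q = D*_{U₀}0`, a route bond `b` with centre
`x := e(b₋)`, `‖u(z)‖ ≤ M_u` and `‖q(z)‖ ≤ M_q` on the sup-ball `tdist x z ≤ 12ℓ + 4`, the no-wrap room at `R = 12ℓ + 4`, and every bound `G_b` of `‖(D_{U₀}u)(e b′)‖` on the bonds `b′`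
with `d(B b₋, B b′₋) ≤ 51`:
`‖(D_{U₀}u)(e b)‖ ≤ (C_g·(M_u·(2 + 2√2·4ε₀(3 + 2457C) + (24√10 + 48)(48ε₀)²) + M_q) + 2√2·48ε₀·M_u) + C_g·(48ε₀(6√2√10 + 6√2))·G_b`
(`C_g := exists_curved_localGradient.choose`, `C := norm_bgOfCfg_axialT_sub_le.choose`) — T1-core's §1 with its letters read only where the proof reads them.
[cite: Balaban1985BackgroundPropagators, Thm 3.1 (3.43)–(3.47) pp.398–399; Balaban1985Averaging, pp.24-25] -/
theorem perBond_gradient_le_of_ball (u q : SiteL2K ℂ 3 (periodsT3 F K) c₀ W₂)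
    (h : covLapSite F n K c₀ U₀ u + q = DstarL2 F n K c₀ U₀ 0) (b : PBond (F.P K) 0) {Mu Mq : ℝ} (hMu0 : 0 ≤ Mu) (hMq0 : 0 ≤ Mq)
    (hMu : ∀ z : TSite 3 (periodsT3 F K), tdist (periodsT3 F K) (siteEquiv F K b.src) z ≤ 12 * (F.L : ℝ) ^ (K - n) + 4 →
      ‖WL2.equiv ℂ (fun _ : TSite 3 (periodsT3 F K) => c₀) W₂ u z‖ ≤ Mu)
    (hMq : ∀ z : TSite 3 (periodsT3 F K), tdist (periodsT3 F K) (siteEquiv F K b.src) z ≤ 12 * (F.L : ℝ) ^ (K - n) + 4 →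
      ‖WL2.equiv ℂ (fun _ : TSite 3 (periodsT3 F K) => c₀) W₂ q z‖ ≤ Mq)
    (hroom : 2 * (12 * F.L ^ (K - n) + 5) ≤ (F.P K).sitesPerDir 0)
    (Gb : ℝ)
    (hGb : ∀ b' : PBond (F.P K) 0, (Site.tdist (P := F.P K) (iterBlockOf (K - n) b.src) (iterBlockOf (K - n) b'.src) : ℝ) ≤ 51 →
      ‖WL2.equiv ℂ (fun _ : Bond 3 (periodsT3 F K) => c₀) W₂ (DL2 F n K c₀ U₀ u) (bondEquiv F K b')‖ ≤ Gb) :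
    ‖WL2.equiv ℂ (fun _ : Bond 3 (periodsT3 F K) => c₀) W₂ (DL2 F n K c₀ U₀ u) (bondEquiv F K b)‖
      ≤ (exists_curved_localGradient.choose *
            (Mu * (2 + 2 * Real.sqrt 2 * (4 * ε₀ * (3 + 2457 * norm_bgOfCfg_axialT_sub_le.choose)) + (24 * Real.sqrt 10 + 48) * (48 * ε₀) ^ 2) + Mq)
          + 2 * Real.sqrt 2 * (48 * ε₀) * Mu)
        + exists_curved_localGradient.choose * ((48 * ε₀) * (6 * Real.sqrt 2 * Real.sqrt 10 + 6 * Real.sqrt 2)) * Gb := by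
  classical
  -- the two universal constants
  obtain ⟨hCg0, hG13a⟩ := exists_curved_localGradient.choose_spec
  set Cg : ℝ := exists_curved_localGradient.choose with hCg
  obtain ⟨hC0, hΘrow⟩ := norm_bgOfCfg_axialT_sub_le.choose_spec
  set C : ℝ := norm_bgOfCfg_axialT_sub_le.choose with hCdef
  clear_value Cg C
  -- scales and radius
  have hP1 : ∀ i, 1 ≤ periodsT3 F K i := one_le_periodsT3 F K
  have hL1 : (1 : ℝ) ≤ (F.L : ℝ) := by have := F.hL.2; exact_mod_cast this.le
  have hℓ1 : (1 : ℝ) ≤ (F.L : ℝ) ^ (K - n) := one_le_pow₀ hL1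
  have hℓ0 : (0 : ℝ) < (F.L : ℝ) ^ (K - n) := by positivity
  set R : ℕ := 12 * F.L ^ (K - n) + 4 with hRdef
  have hRℝ : (R : ℝ) = 12 * (F.L : ℝ) ^ (K - n) + 4 := natCast_radius F n K
  have hroom' : 2 * (R + 1) ≤ (F.P K).sitesPerDir 0 := by rw [hRdef]; omega
  have hε0 : 0 ≤ ε₀ := hε₀.le
  -- the bond, the gauge, the isometries
  set c : Site (F.P K) 0 := b.src with hc
  set x : TSite 3 (periodsT3 F K) := siteEquiv F K c with hx
  set V : GaugeField (F.P K) 0 (Matrix.specialUnitaryGroup (Fin 2) ℂ) := GaugeField.gaugeAct (axialT U₀ c) U₀ with hV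
  obtain ⟨Φ, Ψ, -, -, hP1Φ, -, hU⟩ := exists_adIsometries_pointwise F n K c₀ (axialT U₀ c)
  obtain ⟨-, hDstar, hΔ, hDpt, -, -⟩ := hU U₀
  -- the transported equation
  have htrans : covLapSite F n K c₀ V (Φ u) + Φ q = DstarL2 F n K c₀ V 0 := by
    have := memberEquation_gaugeAct F n K c₀ (axialT U₀ c) U₀ Φ Ψ hDstar hΔ h
    simpa only [map_zero] using this
  -- the sup letters transport pointwise (on the ball)
  have hMuV : ∀ z, tdist (periodsT3 F K) x z ≤ 12 * (F.L : ℝ) ^ (K - n) + 4 →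
      ‖WL2.equiv ℂ (fun _ : TSite 3 (periodsT3 F K) => c₀) W₂ (Φ u) z‖ ≤ Mu := fun z hz => by rw [hP1Φ]; exact hMu z hz
  have hMqV : ∀ z, tdist (periodsT3 F K) x z ≤ 12 * (F.L : ℝ) ^ (K - n) + 4 →
      ‖WL2.equiv ℂ (fun _ : TSite 3 (periodsT3 F K) => c₀) W₂ (Φ q) z‖ ≤ Mq := fun z hz => by rw [hP1Φ]; exact hMq z hz
  -- the background rows of `V` : `δ` on the big ball, `Θ` on the `4ℓ`-ball
  set δ : ℝ := 3 * (R : ℝ) * regThreshold F n K ε₀ with hδdef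
  have hδ0 : 0 ≤ δ := by rw [hδdef]; unfold regThreshold; positivity
  have hδBall : ∀ (z : TSite 3 (periodsT3 F K)) (μ : Fin 3), tdist (periodsT3 F K) x z ≤ 12 * (F.L : ℝ) ^ (K - n) + 4 →
      ‖((bgOfCfg F K V (z, μ) : (Matrix (Fin 2) (Fin 2) ℂ)ˣ) : Matrix (Fin 2) (Fin 2) ℂ) - 1‖ ≤ δ := by
    intro z μ hz
    exact norm_bgOfCfg_axialT_sub_one_le_of_ball F n K hε0 U₀ hreg.1 c hroom' z μ (by rw [hRℝ]; exact hz)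
  have hℓδ : (F.L : ℝ) ^ (K - n) * δ ≤ 48 * ε₀ := by rw [hδdef]; exact ell_mul_delta_ball_le F n K hε0
  set Θ : ℝ := (3 * (ε₀ * ((F.L : ℝ)⁻¹) ^ (2 * (K - n))) + (3 : ℝ) ^ 2 * (C * ((ε₀ * ((F.L : ℝ)⁻¹) ^ (2 * (K - n))) +
      R * (ε₀ * ((F.L : ℝ)⁻¹) ^ (3 * (K - n))) + (R : ℝ) ^ 2 * (ε₀ * ((F.L : ℝ)⁻¹) ^ (2 * (K - n))) ^ 2))) * Real.sqrt ((R : ℝ) * (F.L : ℝ) ^ (K - n)) with hΘdef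
  have hΘ0 : 0 ≤ Θ := by
    have : (0 : ℝ) ≤ ((F.L : ℝ)⁻¹) := inv_nonneg.2 (Nat.cast_nonneg _)
    positivity
  have hΘBall := hΘrow F n K ε₀ hε0 hε1 U₀ hreg.1 hreg.2 c x 0 R (by rw [hx, B4Sect5Torus.tdist_self]; norm_num) (by omega) hroom'
  have hℓΘ : (F.L : ℝ) ^ (K - n) * Θ ≤ 4 * ε₀ * (3 + 2457 * C) := by rw [hΘdef]; exact ell_mul_theta_ball_le F n K hε0 hε1 hC0
  -- the η-GRADIENT LETTER `G := G_b + 2√2·(48ε₀)·M_u` on the `12ℓ+3`-ball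
  have hGb0 : 0 ≤ Gb := (norm_nonneg _).trans (hGb b (by rw [B3Taylor310LocalRemainder.tdist_self]; norm_num))
  set Gt : ℝ := Gb + 2 * Real.sqrt 2 * (48 * ε₀) * Mu with hGt
  have hGt0 : 0 ≤ Gt := by positivity
  have hGBall : ∀ (z : TSite 3 (periodsT3 F K)) (μ : Fin 3), tdist (periodsT3 F K) x z ≤ 12 * (F.L : ℝ) ^ (K - n) + 3 →
      (F.L : ℝ) ^ (K - n) * ‖WL2.equiv ℂ (fun _ : TSite 3 (periodsT3 F K) => c₀) W₂ (Φ u) (shift μ z) -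
        WL2.equiv ℂ (fun _ : TSite 3 (periodsT3 F K) => c₀) W₂ (Φ u) z‖ ≤ Gt := by
    intro z μ hz
    -- the covariant gradient at `(z, μ)` is the gauge-invariant `g(b′)`, `b′ = ⟨e⁻¹ z, μ⟩`
    have hcov : ‖WL2.equiv ℂ (fun _ : Bond 3 (periodsT3 F K) => c₀) W₂ (DL2 F n K c₀ V (Φ u)) (z, μ)‖ ≤ Gb := by
      rw [hV, hDpt]
      have hb' : bondEquiv F K (⟨(siteEquiv F K).symm z, μ⟩ : PBond (F.P K) 0) = (z, μ) := by
        simp [bondEquiv_apply]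
      have := hGb ⟨(siteEquiv F K).symm z, μ⟩ (tdist_iterBlockOf_le_of_ball F n K c z (by linarith only [hz]))
      rwa [hb'] at this
    have hz1 : tdist (periodsT3 F K) x (shift μ z) ≤ 12 * (F.L : ℝ) ^ (K - n) + 4 := by
      have h1 := tdist_triangle hP1 x z (shift μ z)
      have h2 := tdist_shift_le hP1 μ z
      linarith only [h1, h2, hz]
    have h1 := ell_mul_norm_sub_le_of_rows F n K c₀ V (Φ u) z μ hcov (hδBall z μ (by linarith only [hz])) (hMuV _ hz1)
    calc _ ≤ Gb + 2 * Real.sqrt 2 * ((F.L : ℝ) ^ (K - n) * δ) * Mu := h1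
      _ ≤ Gb + 2 * Real.sqrt 2 * (48 * ε₀) * Mu :=
          add_le_add le_rfl (mul_le_mul_of_nonneg_right (mul_le_mul_of_nonneg_left hℓδ (by positivity : (0 : ℝ) ≤ 2 * Real.sqrt 2)) hMu0)
  -- (G1-3a) at `(V, Φu, Φq, 0, x)` with `M_f = H_f := 0`
  have h13 := hG13a F n K c₀ V (Φ u) (Φ q) 0 x Mu Gt 0 0 Mq δ Θ hMu0 hGt0 le_rfl le_rfl hMq0 hδ0 hΘ0 htrans
    (fun z hz => hMuV z (by linarith only [hz, hℓ1])) hGBall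
    (fun z μ _ => by rw [WL2.equiv_zero, Pi.zero_apply, norm_zero])
    (fun z z' μ _ _ => by rw [WL2.equiv_zero, Pi.zero_apply, Pi.zero_apply, sub_self, norm_zero, zero_mul])
    (fun z hz => hMqV z (by linarith only [hz, hℓ1])) (fun z μ hz => hδBall z μ (by linarith only [hz, hℓ1])) hΘBall b.dir
  -- read back `g(b) = ‖(D_V Φu)(x, b.dir)‖`
  have hread : ‖WL2.equiv ℂ (fun _ : Bond 3 (periodsT3 F K) => c₀) W₂ (DL2 F n K c₀ U₀ u) (bondEquiv F K b)‖
      ≤ (F.L : ℝ) ^ (K - n) * ‖WL2.equiv ℂ (fun _ : TSite 3 (periodsT3 F K) => c₀) W₂ (Φ u) (shift b.dir x) -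
          WL2.equiv ℂ (fun _ : TSite 3 (periodsT3 F K) => c₀) W₂ (Φ u) x‖ + 2 * Real.sqrt 2 * (48 * ε₀) * Mu := by
    have hb : bondEquiv F K b = (x, b.dir) := by rw [bondEquiv_apply]
    rw [hb, ← hDpt, ← hV]
    have hx0 : tdist (periodsT3 F K) x x ≤ 12 * (F.L : ℝ) ^ (K - n) + 4 := by rw [B4Sect5Torus.tdist_self]; positivity
    have hx1 : tdist (periodsT3 F K) x (shift b.dir x) ≤ 12 * (F.L : ℝ) ^ (K - n) + 4 := by
      have := tdist_shift_le hP1 b.dir x; linarith only [this, hℓ1]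
    have h1 := norm_DL2_le n V (Φ u) x b.dir
    have h2 : 2 * Real.sqrt 2 * ‖((bgOfCfg F K V (x, b.dir) : (Matrix (Fin 2) (Fin 2) ℂ)ˣ) : Matrix (Fin 2) (Fin 2) ℂ) - 1‖
        * ‖WL2.equiv ℂ (fun _ : TSite 3 (periodsT3 F K) => c₀) W₂ (Φ u) (shift b.dir x)‖ ≤ 2 * Real.sqrt 2 * δ * Mu :=
      mul_le_mul (mul_le_mul_of_nonneg_left (hδBall x b.dir hx0) (by positivity)) (hMuV _ hx1) (norm_nonneg _) (by positivity)
    have h3 : (F.L : ℝ) ^ (K - n) * (2 * Real.sqrt 2 * δ * Mu) ≤ 2 * Real.sqrt 2 * (48 * ε₀) * Mu := by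
      have := mul_le_mul_of_nonneg_right (mul_le_mul_of_nonneg_left hℓδ (by positivity : (0 : ℝ) ≤ 2 * Real.sqrt 2)) hMu0
      calc (F.L : ℝ) ^ (K - n) * (2 * Real.sqrt 2 * δ * Mu) = 2 * Real.sqrt 2 * ((F.L : ℝ) ^ (K - n) * δ) * Mu := by ring
        _ ≤ _ := this
    calc _ ≤ (F.L : ℝ) ^ (K - n) * (‖WL2.equiv ℂ (fun _ : TSite 3 (periodsT3 F K) => c₀) W₂ (Φ u) (shift b.dir x) -
              WL2.equiv ℂ (fun _ : TSite 3 (periodsT3 F K) => c₀) W₂ (Φ u) x‖ + 2 * Real.sqrt 2 * δ * Mu) :=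
          h1.trans (mul_le_mul_of_nonneg_left (add_le_add le_rfl h2) hℓ0.le)
      _ = _ := mul_add _ _ _
      _ ≤ _ := add_le_add le_rfl h3
  -- regroup
  have hkey := hread.trans (add_le_add h13 le_rfl)
  have hreg' := regroup_bracket (Cg := Cg) (Mu := Mu) (Mq := Mq) (Gb := Gb) hCg0 hMu0 hGb0 (mul_nonneg hℓ0.le hδ0) (mul_nonneg hℓ0.le hΘ0) hℓδ hℓΘ
  have hfin : Cg * (Mu + (0 + 2 * Real.sqrt 2 * ((F.L : ℝ) ^ (K - n) * Θ * Mu + (F.L : ℝ) ^ (K - n) * δ * (3 * Real.sqrt 10 * Gt)))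
        + (6 * Real.sqrt 2 * ((F.L : ℝ) ^ (K - n) * δ) * (0 + Gt + 2 * Real.sqrt 2 * ((F.L : ℝ) ^ (K - n) * δ) * Mu) + Mu + Mq))
      + 2 * Real.sqrt 2 * (48 * ε₀) * Mu
      ≤ (Cg * (Mu * (2 + 2 * Real.sqrt 2 * (4 * ε₀ * (3 + 2457 * C)) + (24 * Real.sqrt 10 + 48) * (48 * ε₀) ^ 2) + Mq) + 2 * Real.sqrt 2 * (48 * ε₀) * Mu)
        + Cg * ((48 * ε₀) * (6 * Real.sqrt 2 * Real.sqrt 10 + 6 * Real.sqrt 2)) * Gb := by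
    rw [hGt]
    exact hreg'
  exact hkey.trans hfin

/-! ## §2 ★★★ The decayed gradient row -/

include hε₀ hε1 hreg in
/-- ★★★ **THE DECAYED GRADIENT ROW OF A COVARIANT POISSON-TYPE EQUATION** ([Balaban1985BackgroundPropagators] Thm 3.1 (3.42)–(3.44), weighted-sup edition at a regular curved
background).  For `u q` with `Δ^η_{U₀}u + q = D*_{U₀}0`, a block `y`, a rate `κ ≥ 0` and decayed sup letters `‖u(e x)‖ ≤ A_u·e^{−κ·d(B x, y)}`, `‖q(e x)‖ ≤ A_q·e^{−κ·d(B x, y)}` (coarse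
`ℓ¹` block distance), the no-wrap room and the margin `C_g·(48ε₀(6√2√10 + 6√2))·e^{51κ} ≤ ½`:
`‖(D_{U₀}u)(e b)‖ ≤ 2·(C_g·(A_u e^{51κ}·(2 + 2√2·4ε₀(3 + 2457C) + (24√10 + 48)(48ε₀)²) + A_q e^{51κ}) + 2√2·48ε₀·A_u e^{51κ})·e^{−κ·d(B b₋, y)}` at EVERY route bond `b`
— §1 on the ball (✓`decay_on_ball`: the letters cost `e^{51κ}` there) is the `hloc` of ✓`weighted_sup_absorption` with `near b b′ := d(B b₋, B b′₋) ≤ 51`.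
[cite: Balaban1985BackgroundPropagators, Thm 3.1 (3.42)–(3.44) pp.397–398; Balaban1984PropagatorsII, Lemma 2.1 (2.61)–(2.63) p.234] -/
theorem gradient_decay_of_decay (u q : SiteL2K ℂ 3 (periodsT3 F K) c₀ W₂)
    (h : covLapSite F n K c₀ U₀ u + q = DstarL2 F n K c₀ U₀ 0) (y : Site (F.P K) (K - n)) {κ Au Aq : ℝ} (hκ : 0 ≤ κ) (hAu : 0 ≤ Au) (hAq : 0 ≤ Aq)
    (hu : ∀ x : Site (F.P K) 0, ‖WL2.equiv ℂ (fun _ : TSite 3 (periodsT3 F K) => c₀) W₂ u (siteEquiv F K x)‖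
      ≤ Au * Real.exp (-(κ * (Site.tdist (P := F.P K) (iterBlockOf (K - n) x) y : ℝ))))
    (hq : ∀ x : Site (F.P K) 0, ‖WL2.equiv ℂ (fun _ : TSite 3 (periodsT3 F K) => c₀) W₂ q (siteEquiv F K x)‖
      ≤ Aq * Real.exp (-(κ * (Site.tdist (P := F.P K) (iterBlockOf (K - n) x) y : ℝ))))
    (hroom : 2 * (12 * F.L ^ (K - n) + 5) ≤ (F.P K).sitesPerDir 0)
    (hsmall : exists_curved_localGradient.choose * ((48 * ε₀) * (6 * Real.sqrt 2 * Real.sqrt 10 + 6 * Real.sqrt 2)) * Real.exp (51 * κ) ≤ 1 / 2) :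
    ∀ b : PBond (F.P K) 0, ‖WL2.equiv ℂ (fun _ : Bond 3 (periodsT3 F K) => c₀) W₂ (DL2 F n K c₀ U₀ u) (bondEquiv F K b)‖
      ≤ 2 * ((exists_curved_localGradient.choose *
            ((Au * Real.exp (51 * κ)) * (2 + 2 * Real.sqrt 2 * (4 * ε₀ * (3 + 2457 * norm_bgOfCfg_axialT_sub_le.choose)) + (24 * Real.sqrt 10 + 48) * (48 * ε₀) ^ 2)
              + Aq * Real.exp (51 * κ))
          + 2 * Real.sqrt 2 * (48 * ε₀) * (Au * Real.exp (51 * κ))))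
        * Real.exp (-(κ * (Site.tdist (P := F.P K) (iterBlockOf (K - n) b.src) y : ℝ))) := by
  classical
  have hP1 : ∀ i, 1 ≤ periodsT3 F K i := one_le_periodsT3 F K
  set M : ℝ := (exists_curved_localGradient.choose *
            ((Au * Real.exp (51 * κ)) * (2 + 2 * Real.sqrt 2 * (4 * ε₀ * (3 + 2457 * norm_bgOfCfg_axialT_sub_le.choose)) + (24 * Real.sqrt 10 + 48) * (48 * ε₀) ^ 2)
              + Aq * Real.exp (51 * κ))
          + 2 * Real.sqrt 2 * (48 * ε₀) * (Au * Real.exp (51 * κ))) with hM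
  have habs := weighted_sup_absorption (ι := PBond (F.P K) 0)
    (fun b' => ‖WL2.equiv ℂ (fun _ : Bond 3 (periodsT3 F K) => c₀) W₂ (DL2 F n K c₀ U₀ u) (bondEquiv F K b')‖)
    (fun b' => (Site.tdist (P := F.P K) (iterBlockOf (K - n) b'.src) y : ℝ))
    (fun b' => M * Real.exp (-(κ * (Site.tdist (P := F.P K) (iterBlockOf (K - n) b'.src) y : ℝ))))
    (fun b' b'' => (Site.tdist (P := F.P K) (iterBlockOf (K - n) b'.src) (iterBlockOf (K - n) b''.src) : ℝ) ≤ 51)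
    (Cg := 1) (a := exists_curved_localGradient.choose * ((48 * ε₀) * (6 * Real.sqrt 2 * Real.sqrt 10 + 6 * Real.sqrt 2)))
    (M := M) (κ := κ) (D := 51) hκ zero_le_one (fun _ => norm_nonneg _)
    (fun b' b'' hb => by
      have ht : (Site.tdist (iterBlockOf (K - n) b'.src) y : ℝ)
          ≤ (Site.tdist (iterBlockOf (K - n) b'.src) (iterBlockOf (K - n) b''.src) : ℝ) + (Site.tdist (iterBlockOf (K - n) b''.src) y : ℝ) := by
        exact_mod_cast B3Taylor310LocalRemainder.tdist_triangle (iterBlockOf (K - n) b'.src) (iterBlockOf (K - n) b''.src) y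
      linarith)
    (fun b' Gb hGb => by
      rw [one_mul]
      -- the two letters on the ball of `b′₋`, with the slack `e^{51κ}`
      set Ed : ℝ := Real.exp (-(κ * (Site.tdist (P := F.P K) (iterBlockOf (K - n) b'.src) y : ℝ))) with hEd
      have hMuBall : ∀ z, tdist (periodsT3 F K) (siteEquiv F K b'.src) z ≤ 12 * (F.L : ℝ) ^ (K - n) + 4 →
          ‖WL2.equiv ℂ (fun _ : TSite 3 (periodsT3 F K) => c₀) W₂ u z‖ ≤ Au * Real.exp (51 * κ) * Ed := fun z hz =>
        decay_on_ball F n K (f := fun t => ‖WL2.equiv ℂ (fun _ : TSite 3 (periodsT3 F K) => c₀) W₂ u t‖) hAu hκ y hu b'.src z hz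
      have hMqBall : ∀ z, tdist (periodsT3 F K) (siteEquiv F K b'.src) z ≤ 12 * (F.L : ℝ) ^ (K - n) + 4 →
          ‖WL2.equiv ℂ (fun _ : TSite 3 (periodsT3 F K) => c₀) W₂ q z‖ ≤ Aq * Real.exp (51 * κ) * Ed := fun z hz =>
        decay_on_ball F n K (f := fun t => ‖WL2.equiv ℂ (fun _ : TSite 3 (periodsT3 F K) => c₀) W₂ q t‖) hAq hκ y hq b'.src z hz
      have h1 := perBond_gradient_le_of_ball F n K hε₀ hε1 U₀ hreg c₀ u q h b' (by positivity) (by positivity) hMuBall hMqBall hroom Gb hGb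
      refine h1.trans (le_of_eq ?_)
      rw [hM]; ring)
    (fun _ => le_rfl)
    (by rw [one_mul, mul_comm κ 51]; exact hsmall)
  intro b
  have := habs b
  calc _ ≤ 2 * 1 * M * Real.exp (-(κ * (Site.tdist (P := F.P K) (iterBlockOf (K - n) b.src) y : ℝ))) := this
    _ = _ := by ring

include hε₀ hε1 hreg in
/-- ★★ **THE DECAYED GRADIENT ROW, ROUTE-MATRIX READING**: the same bound for `‖toL2⁻¹(D_{U₀}u) b‖` (operator norm of the route matrix ≤ Frobenius norm = the `W₂` reading at `e b`,
✓`norm_frobEquiv_le`). [cite: Balaban1985BackgroundPropagators, Thm 3.1 (3.42)–(3.44) pp.397–398, (3.11) p.392] -/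
theorem gradient_decay_of_decay' (u q : SiteL2K ℂ 3 (periodsT3 F K) c₀ W₂)
    (h : covLapSite F n K c₀ U₀ u + q = DstarL2 F n K c₀ U₀ 0) (y : Site (F.P K) (K - n)) {κ Au Aq : ℝ} (hκ : 0 ≤ κ) (hAu : 0 ≤ Au) (hAq : 0 ≤ Aq)
    (hu : ∀ x : Site (F.P K) 0, ‖WL2.equiv ℂ (fun _ : TSite 3 (periodsT3 F K) => c₀) W₂ u (siteEquiv F K x)‖
      ≤ Au * Real.exp (-(κ * (Site.tdist (P := F.P K) (iterBlockOf (K - n) x) y : ℝ))))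
    (hq : ∀ x : Site (F.P K) 0, ‖WL2.equiv ℂ (fun _ : TSite 3 (periodsT3 F K) => c₀) W₂ q (siteEquiv F K x)‖
      ≤ Aq * Real.exp (-(κ * (Site.tdist (P := F.P K) (iterBlockOf (K - n) x) y : ℝ))))
    (hroom : 2 * (12 * F.L ^ (K - n) + 5) ≤ (F.P K).sitesPerDir 0)
    (hsmall : exists_curved_localGradient.choose * ((48 * ε₀) * (6 * Real.sqrt 2 * Real.sqrt 10 + 6 * Real.sqrt 2)) * Real.exp (51 * κ) ≤ 1 / 2)
    (b : PBond (F.P K) 0) :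
    ‖(toL2 F K c₀).symm (DL2 F n K c₀ U₀ u) b‖
      ≤ 2 * ((exists_curved_localGradient.choose *
            ((Au * Real.exp (51 * κ)) * (2 + 2 * Real.sqrt 2 * (4 * ε₀ * (3 + 2457 * norm_bgOfCfg_axialT_sub_le.choose)) + (24 * Real.sqrt 10 + 48) * (48 * ε₀) ^ 2)
              + Aq * Real.exp (51 * κ))
          + 2 * Real.sqrt 2 * (48 * ε₀) * (Au * Real.exp (51 * κ))))
        * Real.exp (-(κ * (Site.tdist (P := F.P K) (iterBlockOf (K - n) b.src) y : ℝ))) := by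
  rw [toL2_symm_apply]
  exact (norm_frobEquiv_le _).trans (gradient_decay_of_decay F n K hε₀ hε1 U₀ hreg c₀ u q h y hκ hAu hAq hu hq hroom hsmall b)

end Summit.QuantumFields.YangMills.Theorems.Prop7PoissonGradientDecay

end
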